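import Mathlib
import HarnessLib
import HarnessLib.Audit.Tags
import Literature.MathematicalPhysics.QuantumFieldTheory.Balaban1983to89.Setup
import Literature.MathematicalPhysics.QuantumFieldTheory.Balaban1983to89.B14
import Literature.MathematicalPhysics.QuantumFieldTheory.Balaban1983to89.Step
import Literature.MathematicalPhysics.QuantumFieldTheory.Balaban1983to89.B14FlowStep

/-!
# QuantumFields / YangMills — the WEAK WINDOW: Bałaban's flow control is sign-free for the first `c/g₀²` steps
(solo seat `solo-QuantumFields-informed`, session 15)

CONTEXT.  The seat's ladder below the lattice mass-gap core (`PLAN.md` §4: non-freezing NF < Theorem A <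
P6a "tree level at all polynomial scales" < P6 "ξ ≥ e^{cβ}" < P1) rests, from P6a upward, on T. Bałaban's
ultraviolet-stability series for `d = 4` lattice gauge theories (CMP **109**, **116**, **119**, **122** (1987–89)).
Every `d = 4` theorem there carries the INTERVAL HYPOTHESIS `0 < g_k ≤ γ` on the effective couplings, discharged in
print only by the unpublished Thm 2 of CMP 109.  The tree's audit of the series
(`Literature.MathematicalPhysics.QuantumFieldTheory.Balaban1983to89.Dag`, `.B14FlowStep`) located a second input of
the same kind: the inductive description of [Bałaban, *Convergent renormalization expansions…*, CMP 119 (1988)] §2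
consumes the FLOW-CONTROL inequalities (2.6)–(2.9) p. 255–256 and the coupling-sum step of (2.46) p. 263, and from
the PRINTED properties of the β-functions — [Bałaban, CMP 109 (1987)] p. 264: "uniformly bounded on this interval
together with all derivatives", i.e. `|β_{j+1}| ≤ β′` — these follow only for pairs of scales whose lag obeys
`(n − m)γ²β′ ≤ β₀(2+β₀)` (`B14FlowStep.pairFlow_of_betaAbs_lag`, `flowControl_of_partialSum`); for all pairs they
need the UNPRINTED sign / positive lower bound of β (`Dag.Leaves.betaPositive`; witness
`B14FlowStep.printed_hyps_fail_26d_27a`).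

WHAT IS PROVED HERE (sorry-free; pure real analysis over the audit's typed displays; nothing of the series is
asserted).  Start the recursion (0.20) `1/g_k² = 1/g_{k+1}² + β_{k+1}(g_k)` from a BARE inverse-square coupling
`x₀ = 1/g₀²` (for the Wilson action of the summit's Statement, `x₀ ∝ β_bare`) and assume only the printed two-sided
bound `|β_{j+1}(g_j)| ≤ β′` along the flow and positivity of the couplings.  Then on every WINDOW of
`K ≤ β₀(2+β₀)·x₀ / ((1+β₀)²β′)` steps:
* `inv_sq_window` — `x₀ − kβ′ ≤ 1/g_k² ≤ x₀ + kβ′` (`k ≤ K`);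
* `inInterval_of_window` — the interval hypothesis `0 < g_k ≤ γ` holds for every `γ` with `γ²(x₀ − Kβ′) ≥ 1`
  (so it SELF-DISCHARGES from the printed bound: no Thm 2);
* `flowControl_of_window`, `flowControl_of_bareWindow` — ALL of (2.6), (2.7), (2.8), (2.9) hold for ALL pairs
  `m < n ≤ K` with the printed constants (via the audit's `flowControl_of_partialSum` with `B = Kβ′` and the choice
  `γ² = (1+β₀)²/x₀`), given the audit's explicit smallness `SmallnessFor γ β′ β₀ L p` — which for this `γ` is
  largeness of `x₀`, i.e. weakness of the bare coupling;
* `sumIneq246_of_window` — the middle member of (2.46), `Σ_{j≤n} g_j^{κ₀} < g_n^{κ₀−6}` for all `n ≤ K`, from the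
  two-sided confinement `γ₁ ≤ g_j ≤ γ` of the couplings on the window and `K γ^{κ₀} < γ₁^{κ₀−6}` (for the bare
  window: `γ² ≍ 1/x₀`, `γ₁² ≍ 1/x₀`, so this is `K < c x₀³`, implied by `K ≤ c′x₀` once `x₀` is large);
* `window_sharp` — the window length is SHARP up to the factor `(1+β₀)²`: along any flow with constant drift
  `β_{j+1}(g_j) = −β′ < 0` (allowed by the printed hypotheses), the last member of (2.6) fails at the pair `(0, K)`
  as soon as `Kβ′ > β₀(2+β₀)x₀`.

READING (the seat's claim C36/C38, `PLAN.md` §4 P6a–P6, §5 row 2).  The unprinted positivity of Bałaban's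
β-functions — asymptotic freedom beyond one-loop bookkeeping — is consumed by NO located use of the coupling flow
during the first `≍ 1/g₀²` renormalization steps from a weak bare coupling, i.e. on all lattice scales up to
`L^{c/g₀²} = e^{c′β_bare}`: exactly the regime of the seat's rungs P6a (`≍ log β` steps) and P6 (`≍ β` steps).  What
positivity (or CMP 109 Thm 2) buys is the UNBOUNDED window — reaching a prescribed renormalised coupling `g_K = g`
with `K → ∞`, the continuum limit in fixed physical volume — and nothing below it.  The other located gaps of the
series (the audit's census) are inherited unchanged; this file removes one hypothesis in one regime, no more.
HONEST FRAMING: bookkeeping over the audit's displays; NOT progress on the mass gap (every statement here is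
group-blind and true for `U(1)`), and not a claim about any page of the series beyond those the audit typed.

References: T. Bałaban, Commun. Math. Phys. 109 (1987) 249–301, (0.20) p. 256, Thm 3 and (1.22) p. 264;
119 (1988) 243–285, (2.6)–(2.9) pp. 255–256, (2.46) p. 263; 122 (1989) 355–392, Thm 1 p. 355.
Tree: `Balaban1983to89.B14FlowStep` (module docstring §§2–4, sections F–G), `Balaban1983to89.Dag` (leaves
`betaSmoothBounded`, `betaPositive`, `FlowStepPrinted`).
-/

open Finset

noncomputable section

namespace Summit.QuantumFields.YangMills.Theorems

open Literature.MathematicalPhysics.QuantumFieldTheory.Balaban1983to89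
open Literature.MathematicalPhysics.QuantumFieldTheory.Balaban1983to89.B14FlowStep

namespace SoloInformedFlowWindow

variable (F : Flow) (K : ℕ)

/-! ### A. The drift bound: the inverse-square coupling stays within `kβ′` of its bare value -/

/-- From (0.20) and the PRINTED two-sided bound `|β_{j+1}(g_j)| ≤ β′` along the flow:
`x₀ − kβ′ ≤ 1/g_k² ≤ x₀ + kβ′` for `k ≤ K`, where `x₀ = 1/g₀²`. -/
theorem inv_sq_window {β' x₀ : ℝ} (hrg : F.SatisfiesRG K)
    (habs : ∀ j, j < K → |F.β (j + 1) (F.g j)| ≤ β')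
    (hx₀ : 1 / (F.g 0) ^ 2 = x₀) :
    ∀ k, k ≤ K → x₀ - (k : ℝ) * β' ≤ 1 / (F.g k) ^ 2 ∧ 1 / (F.g k) ^ 2 ≤ x₀ + (k : ℝ) * β' := by
  intro k
  induction k with
  | zero =>
    intro _
    simp only [Nat.cast_zero, zero_mul, sub_zero, add_zero]
    exact ⟨hx₀.symm.le, hx₀.le⟩
  | succ k ih =>
    intro hk
    have hk' : k < K := Nat.lt_of_succ_le hk
    obtain ⟨ih1, ih2⟩ := ih hk'.le
    have hrgk := hrg k hk'
    obtain ⟨hb1, hb2⟩ := abs_le.mp (habs k hk')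
    have e : ((k + 1 : ℕ) : ℝ) * β' = (k : ℝ) * β' + β' := by push_cast; ring
    rw [e]
    constructor <;> linarith

/-- The INTERVAL HYPOTHESIS self-discharges on the window: with positive couplings, (0.20), `|β| ≤ β′` and
`γ²(x₀ − Kβ′) ≥ 1`, every `g_k`, `k ≤ K`, lies in `]0, γ]`.  (B12 Thm 2 is not needed for this.) -/
theorem inInterval_of_window {β' x₀ γ : ℝ} (hrg : F.SatisfiesRG K)
    (habs : ∀ j, j < K → |F.β (j + 1) (F.g j)| ≤ β')
    (hx₀ : 1 / (F.g 0) ^ 2 = x₀) (hpos : ∀ k, k ≤ K → 0 < F.g k)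
    (hγ : 0 < γ) (hβ' : 0 ≤ β') (hwin : 1 ≤ γ ^ 2 * (x₀ - (K : ℝ) * β')) :
    F.InInterval γ K := by
  intro k hk
  refine ⟨hpos k hk, ?_⟩
  obtain ⟨h1, _⟩ := inv_sq_window F K hrg habs hx₀ k hk
  have hgk := hpos k hk
  have hkK : (k : ℝ) ≤ K := by exact_mod_cast hk
  have h2 : x₀ - (K : ℝ) * β' ≤ 1 / (F.g k) ^ 2 := by nlinarith
  have h3 : 1 ≤ γ ^ 2 * (1 / (F.g k) ^ 2) :=
    le_trans hwin (mul_le_mul_of_nonneg_left h2 (sq_nonneg γ))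
  have hg2 : 0 < (F.g k) ^ 2 := by positivity
  have hne : (F.g k) ^ 2 ≠ 0 := hg2.ne'
  have h4 : (F.g k) ^ 2 ≤ γ ^ 2 := by
    have h5 := mul_le_mul_of_nonneg_right h3 hg2.le
    have e : γ ^ 2 * (1 / (F.g k) ^ 2) * (F.g k) ^ 2 = γ ^ 2 := by
      rw [mul_assoc, one_div_mul_cancel hne, mul_one]
    linarith
  nlinarith [h4, hgk, hγ]

/-- Lower confinement of the couplings on the window: `γ₁ ≤ g_k` for `k ≤ K` whenever `γ₁²(x₀ + Kβ′) ≤ 1`. -/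
theorem coupling_lower_of_window {β' x₀ γ₁ : ℝ} (hrg : F.SatisfiesRG K)
    (habs : ∀ j, j < K → |F.β (j + 1) (F.g j)| ≤ β')
    (hx₀ : 1 / (F.g 0) ^ 2 = x₀) (hpos : ∀ k, k ≤ K → 0 < F.g k)
    (hγ₁ : 0 < γ₁) (hβ' : 0 ≤ β') (hwin' : γ₁ ^ 2 * (x₀ + (K : ℝ) * β') ≤ 1) :
    ∀ k, k ≤ K → γ₁ ≤ F.g k := by
  intro k hk
  obtain ⟨_, h2⟩ := inv_sq_window F K hrg habs hx₀ k hk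
  have hgk := hpos k hk
  have hkK : (k : ℝ) ≤ K := by exact_mod_cast hk
  have h3 : 1 / (F.g k) ^ 2 ≤ x₀ + (K : ℝ) * β' := by nlinarith
  have hg2 : 0 < (F.g k) ^ 2 := by positivity
  have hne : (F.g k) ^ 2 ≠ 0 := hg2.ne'
  have hA : 0 < x₀ + (K : ℝ) * β' := lt_of_lt_of_le (by positivity) h3
  have h6 : 1 ≤ (F.g k) ^ 2 * (x₀ + (K : ℝ) * β') := by
    have h7 := mul_le_mul_of_nonneg_left h3 hg2.le
    have e : (F.g k) ^ 2 * (1 / (F.g k) ^ 2) = 1 := mul_one_div_cancel hne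
    linarith
  have h5 : γ₁ ^ 2 ≤ (F.g k) ^ 2 := by nlinarith [h6, hwin', hA]
  nlinarith [h5, hgk, hγ₁]

/-- On a window of `K` steps every partial sum of β-terms is `≥ −Kβ′`, from the printed `|β| ≤ β′` alone. -/
theorem window_partialSum_lower {β' : ℝ} (hβ' : 0 ≤ β')
    (habs : ∀ j, j < K → |F.β (j + 1) (F.g j)| ≤ β') :
    ∀ m n, m ≤ n → n ≤ K → -((K : ℝ) * β') ≤ ∑ j ∈ Finset.Ico m n, F.β (j + 1) (F.g j) := by
  intro m n hmn hnK
  have h1 : ∀ j ∈ Finset.Ico m n, -β' ≤ F.β (j + 1) (F.g j) := by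
    intro j hj
    have hjK : j < K := lt_of_lt_of_le (Finset.mem_Ico.mp hj).2 hnK
    exact (abs_le.mp (habs j hjK)).1
  have h2 : ∑ j ∈ Finset.Ico m n, (-β') ≤ ∑ j ∈ Finset.Ico m n, F.β (j + 1) (F.g j) :=
    Finset.sum_le_sum h1
  have h3 : ∑ j ∈ Finset.Ico m n, (-β') = ((n - m : ℕ) : ℝ) * (-β') := by
    simp [Finset.sum_const, Nat.card_Ico, nsmul_eq_mul]
  have h4 : ((n - m : ℕ) : ℝ) ≤ K := by exact_mod_cast le_trans (Nat.sub_le n m) hnK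
  nlinarith [h2, h3, h4]

/-! ### B. Flow control (2.6)–(2.9) on the window, sign-free -/

/-- **FLOW CONTROL ON THE WEAK WINDOW, γ-form.**  (0.20) up to `K`, positive couplings, the PRINTED two-sided
bound `|β_{j+1}(g_j)| ≤ β′`, a bare value `x₀ = 1/g₀²` with `γ²(x₀ − Kβ′) ≥ 1` and the window condition
`Kβ′γ² ≤ β₀(2+β₀)`, plus the audit's explicit smallness `SmallnessFor γ β′ β₀ L p`: then the interval hypothesis
holds AND (2.6), (2.7), (2.8) (for `epsK A₀ p`), (2.9) (for any sizes obeying (2.5) with `r = p`) hold for ALL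
pairs `m < n ≤ K` with the printed constants.  No sign of β is used.
[cite: Balaban1988Convergent, (2.6)–(2.9) pp.255–256] -/
theorem flowControl_of_window {γ β' β₀ : ℝ} {L p : ℕ} (S : SmallnessFor γ β' β₀ L p) {A₀ x₀ : ℝ}
    (hA₀ : 0 ≤ A₀) (R : ℕ → ℕ) (hR : ∀ j, j ≤ K → B14.IsRj L p (F.g j) (R j))
    (hrg : F.SatisfiesRG K) (hpos : ∀ k, k ≤ K → 0 < F.g k)
    (habs : ∀ j, j < K → |F.β (j + 1) (F.g j)| ≤ β')
    (hx₀ : 1 / (F.g 0) ^ 2 = x₀)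
    (hwin : 1 ≤ γ ^ 2 * (x₀ - (K : ℝ) * β'))
    (hB : (K : ℝ) * β' * γ ^ 2 ≤ β₀ * (2 + β₀)) :
    F.InInterval γ K ∧ B14.FlowIneq26 F.g β' β₀ K ∧ B14.FlowIneq27 F.g β' β₀ p K ∧
      B14.FlowIneq28 (epsK A₀ p F) F.g β' β₀ K ∧ FlowIneq29 R F.g L β' β₀ K := by
  have hI : F.InInterval γ K :=
    inInterval_of_window F K hrg habs hx₀ hpos S.γ_pos S.β'_nonneg hwin
  have hub : ∀ j, j < K → F.β (j + 1) (F.g j) ≤ β' := fun j hj => (abs_le.mp (habs j hj)).2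
  have hps := window_partialSum_lower F K S.β'_nonneg habs
  exact ⟨hI, flowControl_of_partialSum F K S hA₀ R hR hrg hI hub hps hB⟩

/-- **FLOW CONTROL ON THE WEAK WINDOW, bare form.**  Choose `γ² = (1+β₀)²/x₀`.  Then for every window
`K` with `Kβ′(1+β₀)² ≤ β₀(2+β₀)·x₀` — length PROPORTIONAL TO THE BARE INVERSE-SQUARE COUPLING — the interval
hypothesis and all of (2.6)–(2.9) hold from the printed inputs alone, provided `x₀` is large enough that this `γ`
satisfies the audit's smallness (`SmallnessFor`: all its conditions are upper bounds on `γ`).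
[cite: Balaban1988Convergent, (2.6)–(2.9) pp.255–256] -/
theorem flowControl_of_bareWindow {γ β' β₀ : ℝ} {L p : ℕ} (S : SmallnessFor γ β' β₀ L p) {A₀ x₀ : ℝ}
    (hA₀ : 0 ≤ A₀) (R : ℕ → ℕ) (hR : ∀ j, j ≤ K → B14.IsRj L p (F.g j) (R j))
    (hrg : F.SatisfiesRG K) (hpos : ∀ k, k ≤ K → 0 < F.g k)
    (habs : ∀ j, j < K → |F.β (j + 1) (F.g j)| ≤ β')
    (hx₀ : 1 / (F.g 0) ^ 2 = x₀)
    (hγx : γ ^ 2 * x₀ = (1 + β₀) ^ 2)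
    (hK : (K : ℝ) * β' * (1 + β₀) ^ 2 ≤ β₀ * (2 + β₀) * x₀) :
    F.InInterval γ K ∧ B14.FlowIneq26 F.g β' β₀ K ∧ B14.FlowIneq27 F.g β' β₀ p K ∧
      B14.FlowIneq28 (epsK A₀ p F) F.g β' β₀ K ∧ FlowIneq29 R F.g L β' β₀ K := by
  have hx₀pos : 0 < x₀ := by rw [← hx₀]; have := hpos 0 (Nat.zero_le _); positivity
  have hγ2 : 0 < γ ^ 2 := by have := S.γ_pos; positivity
  have hB : (K : ℝ) * β' * γ ^ 2 ≤ β₀ * (2 + β₀) := by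
    -- multiply `hK` by `γ²` and use `γ² x₀ = (1+β₀)²`
    have h1 : (K : ℝ) * β' * (1 + β₀) ^ 2 * γ ^ 2 ≤ β₀ * (2 + β₀) * x₀ * γ ^ 2 :=
      mul_le_mul_of_nonneg_right hK hγ2.le
    have e1 : (K : ℝ) * β' * (1 + β₀) ^ 2 * γ ^ 2 = ((K : ℝ) * β' * γ ^ 2) * (γ ^ 2 * x₀) := by
      rw [← hγx]; ring
    have e2 : β₀ * (2 + β₀) * x₀ * γ ^ 2 = (β₀ * (2 + β₀)) * (γ ^ 2 * x₀) := by ring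
    rw [e1, e2] at h1
    have hpos' : 0 < γ ^ 2 * x₀ := mul_pos hγ2 hx₀pos
    exact le_of_mul_le_mul_right h1 hpos'
  have hwin : 1 ≤ γ ^ 2 * (x₀ - (K : ℝ) * β') := by
    have : γ ^ 2 * (x₀ - (K : ℝ) * β') = γ ^ 2 * x₀ - (K : ℝ) * β' * γ ^ 2 := by ring
    rw [this, hγx]
    nlinarith [hB, S.β₀_pos]
  exact flowControl_of_window F K S hA₀ R hR hrg hpos habs hx₀ hwin hB

/-! ### C. The coupling-sum step of (2.46) on the window, sign-free -/

/-- **(2.46), middle member, on a window** from two-sided confinement of the couplings: if `γ₁ ≤ g_j ≤ γ` for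
`j ≤ K` and `K γ^{κ₀} < γ₁^{κ₀−6}`, then `Σ_{j=1}^{n} g_j^{κ₀} < g_n^{κ₀−6}` for every `n ≤ K`.  (The audit shows
that NO `K`-uniform bound of this kind follows from the printed inputs — `B14FlowStep.layerSum_unbounded_printOnly`;
on the weak window none is needed.) [cite: Balaban1988Convergent, (2.46) p.263] -/
theorem sumIneq246_of_window {γ γ₁ : ℝ} {κ₀ : ℕ} (hpos : ∀ k, k ≤ K → 0 < F.g k)
    (hle : ∀ k, k ≤ K → F.g k ≤ γ) (hge : ∀ k, k ≤ K → γ₁ ≤ F.g k) (hγ₁ : 0 < γ₁)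
    (hwin : (K : ℝ) * γ ^ κ₀ < γ₁ ^ (κ₀ - 6)) : SumIneq246 F.g κ₀ K := by
  intro n hnK
  have hγ : 0 ≤ γ := le_trans (hpos 0 (Nat.zero_le _)).le (hle 0 (Nat.zero_le _))
  have h1 : ∀ j ∈ Finset.Icc 1 n, (F.g j) ^ κ₀ ≤ γ ^ κ₀ := by
    intro j hj
    have hjK : j ≤ K := le_trans (Finset.mem_Icc.mp hj).2 hnK
    exact pow_le_pow_left₀ (hpos j hjK).le (hle j hjK) κ₀
  have h2 : ∑ j ∈ Finset.Icc 1 n, (F.g j) ^ κ₀ ≤ (n : ℝ) * γ ^ κ₀ := by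
    calc ∑ j ∈ Finset.Icc 1 n, (F.g j) ^ κ₀ ≤ ∑ j ∈ Finset.Icc 1 n, γ ^ κ₀ := Finset.sum_le_sum h1
      _ = (n : ℝ) * γ ^ κ₀ := by simp [Finset.sum_const, Nat.card_Icc, nsmul_eq_mul]
  have h3 : (n : ℝ) * γ ^ κ₀ ≤ (K : ℝ) * γ ^ κ₀ := by
    have : (n : ℝ) ≤ K := by exact_mod_cast hnK
    exact mul_le_mul_of_nonneg_right this (pow_nonneg hγ _)
  have h4 : γ₁ ^ (κ₀ - 6) ≤ (F.g n) ^ (κ₀ - 6) := pow_le_pow_left₀ hγ₁.le (hge n hnK) _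
  linarith

/-- **(2.46) on the weak window from the bare data**: (0.20), positive couplings, printed `|β| ≤ β′`,
`x₀ = 1/g₀²`, an upper scale `γ` with `γ²(x₀ − Kβ′) ≥ 1`, a lower scale `γ₁ > 0` with `γ₁²(x₀ + Kβ′) ≤ 1`, and
`K γ^{κ₀} < γ₁^{κ₀−6}` give the middle member of (2.46) for all `n ≤ K`.  For `Kβ′ ≤ x₀/2` one may take
`γ² = 2/x₀`, `γ₁² = 2/(3x₀)`, and the last condition reads `K < c_{κ₀} x₀³`. [cite: Balaban1988Convergent, (2.46) p.263] -/
theorem sumIneq246_of_bareWindow {β' x₀ γ γ₁ : ℝ} {κ₀ : ℕ} (hrg : F.SatisfiesRG K)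
    (hpos : ∀ k, k ≤ K → 0 < F.g k)
    (habs : ∀ j, j < K → |F.β (j + 1) (F.g j)| ≤ β') (hβ' : 0 ≤ β')
    (hx₀ : 1 / (F.g 0) ^ 2 = x₀) (hγ : 0 < γ) (hγ₁ : 0 < γ₁)
    (hwin : 1 ≤ γ ^ 2 * (x₀ - (K : ℝ) * β')) (hwin' : γ₁ ^ 2 * (x₀ + (K : ℝ) * β') ≤ 1)
    (hwin246 : (K : ℝ) * γ ^ κ₀ < γ₁ ^ (κ₀ - 6)) : SumIneq246 F.g κ₀ K := by
  have hI := inInterval_of_window F K hrg habs hx₀ hpos hγ hβ' hwin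
  have hle : ∀ k, k ≤ K → F.g k ≤ γ := fun k hk => (hI k hk).2
  have hge := coupling_lower_of_window F K hrg habs hx₀ hpos hγ₁ hβ' hwin'
  exact sumIneq246_of_window F K hpos hle hge hγ₁ hwin246

/-! ### D. Sharpness of the window -/

/-- **The window length is sharp up to `(1+β₀)²`.**  Along any flow satisfying (0.20) with positive couplings and
CONSTANT NEGATIVE DRIFT `β_{j+1}(g_j) = −β′` for `j < K` (allowed by every printed property of the β-functions —
cf. the audit's explicit anti-free flow `B14FlowStep.printed_hyps_fail_26d_27a`), the last member of (2.6) FAILS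
at the pair `(0, K)` as soon as `Kβ′ > β₀(2+β₀)·x₀`, `x₀ = 1/g₀²`.  So beyond windows of length `≍ x₀/β′` the sign
of β is genuinely consumed. [cite: Balaban1988Convergent, (2.6) p.255] -/
theorem window_sharp {β' β₀ x₀ : ℝ} (hβ₀ : 0 ≤ β₀) (hK : 0 < K) (hrg : F.SatisfiesRG K)
    (hpos : ∀ k, k ≤ K → 0 < F.g k)
    (hanti : ∀ j, j < K → F.β (j + 1) (F.g j) = -β')
    (hx₀ : 1 / (F.g 0) ^ 2 = x₀)
    (hlong : β₀ * (2 + β₀) * x₀ < (K : ℝ) * β') :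
    ¬ B14.FlowIneq26 F.g β' β₀ K := by
  intro h26
  have h := (h26 0 K hK le_rfl).2
  have hsum : ∑ j ∈ Finset.Ico 0 K, F.β (j + 1) (F.g j) = -((K : ℝ) * β') := by
    rw [Finset.sum_congr rfl (fun j hj => hanti j (Finset.mem_Ico.mp hj).2)]
    simp [Finset.sum_const, nsmul_eq_mul]
  have hiff := (flow26d_iff_partialSum F K β₀ hpos hrg (Nat.zero_le K) le_rfl hβ₀).mp h
  rw [hsum] at hiff
  -- hiff : -(β₀(2+β₀))/g₀² ≤ -(Kβ′), i.e. Kβ′ ≤ β₀(2+β₀) x₀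
  have hg0 : 0 < (F.g 0) ^ 2 := by have := hpos 0 (Nat.zero_le _); positivity
  have e : -(β₀ * (2 + β₀)) / (F.g 0) ^ 2 = -(β₀ * (2 + β₀) * x₀) := by
    rw [← hx₀]; ring
  rw [e] at hiff
  linarith

/-! ### E. Audit root -/

/-- AUDIT ROOT (an item-free file needs one reachable statement; cf. the seat's `HandoverReduction`): the three
findings in one conjunction — (i) from (0.20), positive couplings, the PRINTED `|β| ≤ β′`, a bare value `x₀ = 1/g₀²`
with `γ²x₀ = (1+β₀)²` and the audit's smallness for that `γ`, the interval hypothesis and all of (2.6)–(2.9) hold on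
every window `Kβ′(1+β₀)² ≤ β₀(2+β₀)x₀`; (ii) the coupling-sum member of (2.46) holds on every window on which the
couplings are two-sidedly confined, `γ₁ ≤ g ≤ γ`, with `Kγ^{κ₀} < γ₁^{κ₀−6}`; (iii) sharpness: constant negative
drift `−β′` breaks (2.6) at `(0, K)` once `Kβ′ > β₀(2+β₀)x₀`.  No sign of β, no B12 Thm 2. -/
abbrev WeakWindowDischarge : Prop :=
  (∀ (F : Flow) (K : ℕ) (γ β' β₀ : ℝ) (L p : ℕ), SmallnessFor γ β' β₀ L p →
    ∀ (A₀ x₀ : ℝ), 0 ≤ A₀ → ∀ (R : ℕ → ℕ), (∀ j, j ≤ K → B14.IsRj L p (F.g j) (R j)) →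
    F.SatisfiesRG K → (∀ k, k ≤ K → 0 < F.g k) → (∀ j, j < K → |F.β (j + 1) (F.g j)| ≤ β') →
    1 / (F.g 0) ^ 2 = x₀ → γ ^ 2 * x₀ = (1 + β₀) ^ 2 →
    (K : ℝ) * β' * (1 + β₀) ^ 2 ≤ β₀ * (2 + β₀) * x₀ →
    F.InInterval γ K ∧ B14.FlowIneq26 F.g β' β₀ K ∧ B14.FlowIneq27 F.g β' β₀ p K ∧
      B14.FlowIneq28 (epsK A₀ p F) F.g β' β₀ K ∧ FlowIneq29 R F.g L β' β₀ K) ∧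
  (∀ (F : Flow) (K : ℕ) (β' x₀ γ γ₁ : ℝ) (κ₀ : ℕ), F.SatisfiesRG K → (∀ k, k ≤ K → 0 < F.g k) →
    (∀ j, j < K → |F.β (j + 1) (F.g j)| ≤ β') → 0 ≤ β' → 1 / (F.g 0) ^ 2 = x₀ → 0 < γ → 0 < γ₁ →
    1 ≤ γ ^ 2 * (x₀ - (K : ℝ) * β') → γ₁ ^ 2 * (x₀ + (K : ℝ) * β') ≤ 1 →
    (K : ℝ) * γ ^ κ₀ < γ₁ ^ (κ₀ - 6) → SumIneq246 F.g κ₀ K) ∧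
  (∀ (F : Flow) (K : ℕ) (β' β₀ x₀ : ℝ), 0 ≤ β₀ → 0 < K → F.SatisfiesRG K → (∀ k, k ≤ K → 0 < F.g k) →
    (∀ j, j < K → F.β (j + 1) (F.g j) = -β') → 1 / (F.g 0) ^ 2 = x₀ →
    β₀ * (2 + β₀) * x₀ < (K : ℝ) * β' → ¬ B14.FlowIneq26 F.g β' β₀ K)

/-- `WeakWindowDischarge` holds: `flowControl_of_bareWindow`, `sumIneq246_of_bareWindow`, `window_sharp`. -/
theorem WeakWindowDischarge_holds : WeakWindowDischarge :=
  ⟨fun F K _ _ _ _ _ S _ _ hA₀ R hR hrg hpos habs hx₀ hγx hK =>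
      flowControl_of_bareWindow F K S hA₀ R hR hrg hpos habs hx₀ hγx hK,
    fun F K _ _ _ _ _ hrg hpos habs hβ' hx₀ hγ hγ₁ hwin hwin' h246 =>
      sumIneq246_of_bareWindow F K hrg hpos habs hβ' hx₀ hγ hγ₁ hwin hwin' h246,
    fun F K _ _ _ hβ₀ hK hrg hpos hanti hx₀ hlong =>
      window_sharp F K hβ₀ hK hrg hpos hanti hx₀ hlong⟩

end SoloInformedFlowWindow

end Summit.QuantumFields.YangMills.Theorems

end
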